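import Literature.IUT.HodgeArakelov.MonoThetaProjectiveR
import Literature.IUT.HodgeArakelov.MonoThetaCyclotomesBridgeEtTh
import Literature.AnabelianGeometry.EtaleTheta.Discharge.Sec2ModelKummerLifting

/-!
# Bridge B8, part 5: [IUTchII] Prop. 1.5's model family and model reductions over `ℕ_{≥1}`, from the
# GENUINE [EtTh] models of an [EtTh] §1 theta setting (merge TODO-merge:abc-iut-L2-t2 of
# `MonoThetaProjectiveR`)

abc-iut cell, MERGE-MAP §8 **B8** (layer L6 ↔ L2), continuation of `MonoThetaCyclotomesBridgeEtTh` (part 3,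
abc-iut-L6-d6), written for GAP-LEDGER row G-w4d030-1 (node IUTchII:Prop1.5(i); seats abc-iut-w4-d030 /
abc-iut-w4-d024). S. Mochizuki, *Inter-universal Teichmüller theory II*, kurims manuscript (Dec. 2020),
Prop. 1.5 p. 29: "`M^Θ_M` is a mod `M` mono-theta environment [which is isomorphic to the mod `M` model
mono-theta environment determined by `X̲̲_k`] … the index `M` … varies multiplicatively among the elements of
`ℕ_{≥1}`" [claim: Mochizuki2012, status: disputed] (IUTchII §1 Prop 1.5, kurims p.29); S. Mochizuki, *The
étale theta function …*, Publ. RIMS **45** (2009), Def. 2.13 (ii) p. 274 (PRIMS PDF p. 48): "where we write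
`M_{N'}` for the mod `N'` mono-theta environment induced by `M`" [cite: MochizukiEtTh2009, Def 2.13(ii) p.48]. v2
(doc-only): quotation marks in this file now enclose verbatim print only (v1 had "we shall write" for print's "we
write", and one quoted paraphrase of Cor. 2.18 (iv), now unquoted; cf. referee lane P DEFECT #180 on the proofs
companion); no Lean content changed.

abc-iut-L6-t1's `ModelFamily S` (`MonoThetaProjective.lean`, p407497) carries the mod-`M` MODEL mono-theta
environments determined by `X̲̲_k`, for every `M ∈ ℕ_{≥1}`, as an INTERFACE, and abc-iut-L6-t19's repair
`ModelFamily.Reductions` (`MonoThetaProjectiveR.lean`) carries the model reductions `red_{M',M}` as an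
INTERFACE (TODO-merge:abc-iut-L2-t2). This file CONSTRUCTS both from an [EtTh] §1 theta setting
`D : EtaleTheta.ThetaSetting p` with a choice `C : E.DoubleUnderline l` of `X̲̲` (abc-iut-L2-t8,
`ThetaEnvOfSetting.lean`), GIVEN a compatible system of cyclotome identifications
`μ_M ≅ (l·Δ_Θ) ⊗ ℤ/Mℤ` at EVERY level `M ∈ ℕ_{≥1}` (`mods`, `hmods`: the `ℕ_{≥1}`-indexed form of L2-t8's
chain-indexed `CyclotomeTower`, supplied by abc-iut-w4-d024's `CyclotomeTowerAllLevels`) and ONE root cocycle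
`f` of `η̲̈^{Θ,l·ℤ×μ₂}` (its reductions `η⁰_M` are the theta cocycles singled out as `s^Θ` of THE models):
* `EtaleLevels.setting` — the [IUTchII] §1 setting of `X̲̲_K` (part 3's `ThetaSetting.ofDoubleUnderline` at
  level `1`), `EtaleLevels.levelSetting M` — the same at level `M`;
* `EtaleLevels.modelFamily : ModelFamily setting` — `modelPi M := Π^tp_{Y̲̲}[μ_M]`, `modelD M := D_Y` (in
  `Aut`), `modelTheta M :=` the `μ_M`-conjugacy class of `Im s^Θ_{η⁰_M}`; `setting_modelFamily`: its `F.setting M`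
  IS `levelSetting M` ON THE NOSE, so parts 1–3 apply at every level;
* `EtaleLevels.chainSet`, `EtaleLevels.cyclotomeTower`, `EtaleLevels.tower` — for `M ∣ M'` a cofinal CHAIN
  `{1, M} ∪ {M'·(k+1)!}` through both levels and L2-t8's tower `thetaEnvTower` on it (so that the CHAIN-indexed
  theorems of [EtTh] §2 — `ThetaEnvTower.*` of abc-iut-L2-t2 and abc-iut-L2-d1 — can be pulled down to any pair of levels;
  `tower_redEnv`: its reduction IS `red_{M',M}` on the nose);
* `EtaleLevels.reductions hslimX : modelFamily.Reductions` — `red_{M',M} := (ζ ↦ ζ^{M'/M}) ⋊ id` ([EtTh] Def. 2.13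
  (ii)); functoriality/surjectivity/continuity PROVED outright, `red_theta` (`[s^Θ] ↦ [s^Θ]`) PROVED from
  L2-d1's `redEnv_sTheta` / `reduces_conj_inMu`, and `red_D` (`D_Y ↦ D_Y`) PROVED from L2-d1's
  `exists_reduces_contMulAut` / `mk_mem_DY_of_reduces` modulo temp-slimness of `Π^tp_X` ([SemiAnbd] Ex. 3.10,
  the tree's interface FACT `IsSlimGroup D.PiTemp`, exactly as in L2-d1's `cor218_iv_reduction_model`).
The discharge of the two hypotheses of `prop15_i'_of_chainRigidity` (`MonoThetaProjectiveProofs.lean`) for THIS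
model family is the proof-only companion `MonoThetaProjectiveBridgeEtThProofs.lean`. HONEST FRAMING:
bookkeeping between two typings; nothing disputed is asserted (the [IUTchII] side is the claim key
`Mochizuki2012`, DISPUTED); no side is taken on [IUTchIII] Cor. 3.12; typed ≠ discharged.
-/

noncomputable section

namespace Literature.IUT.HodgeArakelov

open Literature.AnabelianGeometry.EtaleTheta Literature.AnabelianGeometry.SemiGraphs
open scoped Literature.AnabelianGeometry.EtaleTheta

namespace EtaleLevels

variable {p : ℕ} [Fact p.Prime] {D : Literature.AnabelianGeometry.EtaleTheta.ThetaSetting p}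
  {E : D.EtaleThetaData} {l : ℕ} (C : E.DoubleUnderline l) (hC : D.Compat) (hS : D.Sec2Hyps)
  (hl : l.Prime) (hp2 : p ≠ 2) (hpl : p ≠ l) (hζ : ∃ ζ : D.K, IsPrimitiveRoot ζ (4 * l))
  (mods : ∀ M : ℕ+, D.CyclotomeMod l M)
  (f : contCocycles D.toTheta D.DeltaTheta C.GtpYdduu) (hf : f ∈ C.rootCocycles hC)

/-! ## The distinguished theta cocycles `η⁰_M` (reductions of ONE root cocycle) -/

/-- `η⁰_M := f mod M`, the reduction modulo `M` of the root cocycle `f` of `η̲̈^{Θ,l·ℤ×μ₂}` through the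
identification `μ_M ≅ (l·Δ_Θ) ⊗ ℤ/Mℤ` ([EtTh] Def. 2.13, p. 46 "where we apply the natural isomorphism").
[cite: MochizukiEtTh2009, Def 2.13 p.46] -/
def eta0 (M : ℕ+) : D.GtpYdd.subgroupOf C.Huu → MuN p M := C.modN (mods M) f hf.1

/-- `η⁰_M` is a member of the collection of mod-`M` theta cocycles of `X̲̲`. [cite: MochizukiEtTh2009, Def 2.13 p.46] -/
theorem eta0_mem (M : ℕ+) : eta0 C hC mods f hf M ∈ (C.thetaEnvData (mods M) hC hS).thetaCocycles :=
  ⟨f, hf, rfl⟩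

/-! ## The [IUTchII] §1 settings at every level -/

/-- The [IUTchII] §1 setting of `X̲̲_K` AT LEVEL `M` (part 3's `ThetaSetting.ofDoubleUnderline` with the
level-`M` cyclotome and `s^Θ := s^Θ_{η⁰_M}`). [claim: Mochizuki2012, status: disputed] (IUTchII §1, kurims p.20) -/
def levelSetting (M : ℕ+) : ThetaSetting.{0} :=
  ThetaSetting.ofDoubleUnderline C (mods M) hC hS hl hp2 hpl hζ (eta0_mem C hC hS mods f hf M)

/-- The [IUTchII] §1 setting of `X̲̲_K` (level `N = 1`; the level of the setting is immaterial for Prop. 1.5,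
whose systems run over all `M ∈ ℕ_{≥1}`). [claim: Mochizuki2012, status: disputed] (IUTchII §1, kurims p.20) -/
def setting : ThetaSetting.{0} := levelSetting C hC hS hl hp2 hpl hζ mods f hf 1

/-! ## The model family over `ℕ_{≥1}` -/

/-- **The mod-`M` MODEL mono-theta environments of `X̲̲_K` for every `M ∈ ℕ_{≥1}`** ([IUTchII] Prop. 1.5,
p. 29), as abc-iut-L6-t1's `ModelFamily`: `Π^tp_{Y̲̲}[μ_M]` with `D_Y` (read in `Aut`) and the `μ_M`-conjugacy
class of `Im s^Θ_{η⁰_M}` — the [EtTh] Def. 2.13 (ii) model `modelMono η⁰_M` of abc-iut-L2-t2 at each level.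
[claim: Mochizuki2012, status: disputed] (IUTchII §1 Prop 1.5, kurims p.29) -/
def modelFamily : ModelFamily (setting C hC hS hl hp2 hpl hζ mods f hf) where
  modelPi M := (levelSetting C hC hS hl hp2 hpl hζ mods f hf M).modelPi
  modelD M := (levelSetting C hC hS hl hp2 hpl hζ mods f hf M).modelD
  modelD_inn M := (levelSetting C hC hS hl hp2 hpl hζ mods f hf M).modelD_inn
  modelD_continuous M := (levelSetting C hC hS hl hp2 hpl hζ mods f hf M).modelD_continuous
  modelTheta M := (levelSetting C hC hS hl hp2 hpl hζ mods f hf M).modelTheta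

/-- The setting of the model family with `N` replaced by `M` and the mod-`M` model (`ModelFamily.setting`) IS the level-`M`
setting, on the nose. [claim: Mochizuki2012, status: disputed] (IUTchII §1 Prop 1.5, kurims p.29) -/
theorem setting_modelFamily (M : ℕ+) :
    (modelFamily C hC hS hl hp2 hpl hζ mods f hf).setting M = levelSetting C hC hS hl hp2 hpl hζ mods f hf M :=
  rfl

/-- Hence the model environment of the family at level `M`, read as an [EtTh] datum, IS abc-iut-L2-t2's
model `modelMono η⁰_M` of the level-`M` data (parts 2–3). [cite: MochizukiEtTh2009, Def 2.13(ii) p.47] -/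
theorem toEtale_modelEnv (M : ℕ+) :
    ((modelFamily C hC hS hl hp2 hpl hζ mods f hf).modelEnv M).toEtale =
      (C.thetaEnvData (mods M) hC hS).modelMono (eta0_mem C hC hS mods f hf M) :=
  ThetaSetting.modelEnv_ofThetaEnvData _ _


/-! ## A cofinal chain of levels through `M ∣ M'`, and abc-iut-L2-t8's tower on it

[EtTh] Cor. 2.18 (iv) / 2.19 (ii) and their tree discharges (`ThetaEnvTower.*`, abc-iut-L2-t2 and
abc-iut-L2-d1) are indexed by a cofinal TOTALLY ORDERED `E ⊆ ℕ_{≥1}` with `1 ∈ E` (PRIMS p. 290); [IUTchII]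
Prop. 1.5 runs over all of `ℕ_{≥1}`. For any two levels `M ∣ M'` the chain `{1, M} ∪ {M'·(k+1)! : k ∈ ℕ}` is such
an `E` containing both, so every chain-indexed statement can be pulled down to the pair. -/

/-- `(k+1)!` as a positive natural. [cite: MochizukiEtTh2009, Cor 2.19(ii) p.64] -/
def facSucc (k : ℕ) : ℕ+ := ⟨(k + 1).factorial, Nat.factorial_pos _⟩

/-- `(k+1)!` in `ℕ`. [cite: MochizukiEtTh2009, Cor 2.19(ii) p.64] -/
@[simp] theorem facSucc_coe (k : ℕ) : ((facSucc k : ℕ+) : ℕ) = (k + 1).factorial := rfl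

/-- The chain of levels `{1, M} ∪ {M'·(k+1)! : k ∈ ℕ}` through `M ∣ M'`.
[cite: MochizukiEtTh2009, Cor 2.19(ii) p.64] -/
def chainSet (M M' : ℕ+) : Set ℕ+ := {N | N = 1 ∨ N = M ∨ ∃ k : ℕ, N = M' * facSucc k}

/-- `1` lies on the chain. [cite: MochizukiEtTh2009, Cor 2.19(ii) p.64] -/
theorem one_mem_chainSet (M M' : ℕ+) : (1 : ℕ+) ∈ chainSet M M' := Or.inl rfl

/-- `M` lies on the chain. [cite: MochizukiEtTh2009, Cor 2.19(ii) p.64] -/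
theorem left_mem_chainSet (M M' : ℕ+) : M ∈ chainSet M M' := Or.inr (Or.inl rfl)

/-- `M'` lies on the chain (`M' = M'·1!`). [cite: MochizukiEtTh2009, Cor 2.19(ii) p.64] -/
theorem right_mem_chainSet (M M' : ℕ+) : M' ∈ chainSet M M' :=
  Or.inr (Or.inr ⟨0, by rw [show facSucc 0 = 1 from rfl, mul_one]⟩)

/-- The chain is cofinal in `(ℕ_{≥1}, ∣)`: `n ∣ M'·(n+1)!`. [cite: MochizukiEtTh2009, Cor 2.19(ii) p.64] -/
theorem chainSet_cofinal (M M' : ℕ+) : ∀ n : ℕ+, ∃ N ∈ chainSet M M', n ∣ N := fun n =>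
  ⟨M' * facSucc n, Or.inr (Or.inr ⟨n, rfl⟩), PNat.dvd_iff.2 (by
    rw [PNat.mul_coe, facSucc_coe]
    exact Dvd.dvd.mul_left (Nat.dvd_factorial n.pos (Nat.le_succ _)) _)⟩

/-- The chain is totally ordered by divisibility (this uses `M ∣ M'`).
[cite: MochizukiEtTh2009, Cor 2.19(ii) p.64] -/
theorem chainSet_total {M M' : ℕ+} (h : (M : ℕ) ∣ (M' : ℕ)) :
    ∀ N ∈ chainSet M M', ∀ N' ∈ chainSet M M', N ∣ N' ∨ N' ∣ N := by
  have hfac : ∀ j k : ℕ, j ≤ k → (M' * facSucc j : ℕ+) ∣ M' * facSucc k := fun j k hjk =>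
    PNat.dvd_iff.2 (by
      rw [PNat.mul_coe, PNat.mul_coe, facSucc_coe, facSucc_coe]
      exact Nat.mul_dvd_mul_left _ (Nat.factorial_dvd_factorial (Nat.succ_le_succ hjk)))
  have hM : ∀ k : ℕ, M ∣ M' * facSucc k := fun k =>
    PNat.dvd_iff.2 (by rw [PNat.mul_coe]; exact Dvd.dvd.mul_right h _)
  rintro N (rfl | rfl | ⟨j, rfl⟩) N' (rfl | rfl | ⟨k, rfl⟩)
  · exact Or.inl (one_dvd _)
  · exact Or.inl (one_dvd _)
  · exact Or.inl (one_dvd _)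
  · exact Or.inr (one_dvd _)
  · exact Or.inl dvd_rfl
  · exact Or.inl (hM k)
  · exact Or.inr (one_dvd _)
  · exact Or.inr (hM j)
  · rcases le_total j k with hjk | hkj
    · exact Or.inl (hfac j k hjk)
    · exact Or.inr (hfac k j hkj)

variable (hmods : ∀ (M M' : ℕ+) (h : (M : ℕ) ∣ (M' : ℕ)) (x : D.lDeltaTheta l),
  MuN.red p M M' h ((mods M').red x) = (mods M).red x)

/-- **The compatible system of identifications `μ_N ≅ (l·Δ_Θ) ⊗ ℤ/Nℤ` restricted to the chain through
`M ∣ M'`** — abc-iut-L2-t8's `CyclotomeTower` on `chainSet M M'`. [cite: MochizukiEtTh2009, Cor 2.19(ii) p.64] -/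
def cyclotomeTower {M M' : ℕ+} (h : (M : ℕ) ∣ (M' : ℕ)) : D.CyclotomeTower l (chainSet M M') where
  one_mem := one_mem_chainSet M M'
  cofinal := chainSet_cofinal M M'
  total := chainSet_total h
  mod N := mods N
  red_mod N N' hNN' x := hmods N N' hNN' x

/-- **[EtTh] §2's projective system of theta-environment data of `X̲̲` on the chain through `M ∣ M'`**
(abc-iut-L2-t8's `thetaEnvTower`). [cite: MochizukiEtTh2009, Cor 2.19(ii) p.64] -/
abbrev tower {M M' : ℕ+} (h : (M : ℕ) ∣ (M' : ℕ)) : ThetaEnvTower.{0} (chainSet M M') :=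
  C.thetaEnvTower (cyclotomeTower mods hmods h) hC hS

/-- The level `M` as an element of the chain. [cite: MochizukiEtTh2009, Cor 2.19(ii) p.64] -/
def low {M M' : ℕ+} (_h : (M : ℕ) ∣ (M' : ℕ)) : chainSet M M' := ⟨M, left_mem_chainSet M M'⟩

/-- The level `M'` as an element of the chain. [cite: MochizukiEtTh2009, Cor 2.19(ii) p.64] -/
def high {M M' : ℕ+} (_h : (M : ℕ) ∣ (M' : ℕ)) : chainSet M M' := ⟨M', right_mem_chainSet M M'⟩

/-- `M ∣ M'` inside the chain. [cite: MochizukiEtTh2009, Cor 2.19(ii) p.64] -/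
theorem low_dvd_high {M M' : ℕ+} (h : (M : ℕ) ∣ (M' : ℕ)) : ((low h : chainSet M M') : ℕ+) ∣ (high h : ℕ+) :=
  PNat.dvd_iff.2 h

/-! ## The model reductions `red_{M',M}` ([EtTh] Def. 2.13 (ii): "`M_{N'}` for the mod `N'` mono-theta environment
induced by `M`") -/

/-- The level-`M` [EtTh] data of `X̲̲` (abc-iut-L2-t8's `thetaEnvData` with the level-`M` identification) —
reducible shorthand. [cite: MochizukiEtTh2009, Def 2.13 p.47] -/
abbrev levelData (M : ℕ+) : Literature.AnabelianGeometry.EtaleTheta.ThetaEnvData.{0} M :=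
  C.thetaEnvData (mods M) hC hS

/-- The underlying topological group of the model at level `M` IS `Π^tp_{Y̲̲}[μ_M]` of the level-`M` data
(bookkeeping, on the nose). [cite: MochizukiEtTh2009, Def 2.13(ii) p.47] -/
theorem modelPi_eq (M : ℕ+) :
    ((modelFamily C hC hS hl hp2 hpl hζ mods f hf).modelPi M : Type) = (levelData C hC hS mods M).env :=
  rfl

/-- **The reduction `Π^tp_{Y̲̲}[μ_{M'}] → Π^tp_{Y̲̲}[μ_M]`** for `M ∣ M'`: the power map `ζ ↦ ζ^{M'/M}` on the
cyclotome, the identity on `Π^tp_{Y̲̲}` (abc-iut-L2-t2's `ThetaEnvTower.redEnv`, here for ANY pair of levels of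
`ℕ_{≥1}`). [cite: MochizukiEtTh2009, Def 2.13(ii) p.48] -/
def red {M M' : ℕ+} (h : (M : ℕ) ∣ (M' : ℕ)) :
    (levelData C hC hS mods M').env →* (levelData C hC hS mods M).env :=
  SemidirectProduct.map (MuN.red p M M' h) (MonoidHom.id _) fun g => MonoidHom.ext fun a =>
    MuN.red_gal p M M' h ((levelData C hC hS mods M').augY g : GQp p) a

/-- On the chain through `M ∣ M'`, abc-iut-L2-t2's tower reduction IS `red` ON THE NOSE (so every `ThetaEnvTower`
theorem about `redEnv` is a theorem about `red`). [cite: MochizukiEtTh2009, Def 2.13(ii) p.48] -/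
theorem tower_redEnv {M M' : ℕ+} (h : (M : ℕ) ∣ (M' : ℕ)) :
    (tower C hC hS mods hmods h).redEnv (low h) (high h) (low_dvd_high h) = red C hC hS mods h :=
  rfl

/-- `red` in coordinates: the cyclotome component. [cite: MochizukiEtTh2009, Def 2.13(ii) p.48] -/
@[simp] theorem red_left {M M' : ℕ+} (h : (M : ℕ) ∣ (M' : ℕ)) (x : (levelData C hC hS mods M').env) :
    (red C hC hS mods h x).left = MuN.red p M M' h x.left := rfl

/-- `red` in coordinates: the identity on `Π^tp_{Y̲̲}`. [cite: MochizukiEtTh2009, Def 2.13(ii) p.48] -/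
@[simp] theorem red_right {M M' : ℕ+} (h : (M : ℕ) ∣ (M' : ℕ)) (x : (levelData C hC hS mods M').env) :
    (red C hC hS mods h x).right = x.right := rfl

/-! ### `red` is continuous, onto, functorial -/

include hmods in
/-- `red_{M',M}` is continuous. [cite: MochizukiEtTh2009, Def 2.13(ii) p.48] -/
theorem continuous_red {M M' : ℕ+} (h : (M : ℕ) ∣ (M' : ℕ)) : Continuous (red C hC hS mods h) := by
  rw [← tower_redEnv C hC hS mods hmods h]
  exact (tower C hC hS mods hmods h).continuous_redEnv _ _ _

include hmods in
/-- `red_{M',M}` is onto (`μ_{M'} ↠ μ_M`). [cite: MochizukiEtTh2009, Def 2.13(ii) p.48] -/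
theorem red_surjective {M M' : ℕ+} (h : (M : ℕ) ∣ (M' : ℕ)) : Function.Surjective (red C hC hS mods h) := by
  rw [← tower_redEnv C hC hS mods hmods h]
  exact (tower C hC hS mods hmods h).redEnv_surjective _ _ _

/-- `red_{M,M} = id`. [cite: MochizukiEtTh2009, Def 2.13(ii) p.48] -/
theorem red_refl (M : ℕ+) (x : (levelData C hC hS mods M).env) :
    red C hC hS mods (dvd_refl (M : ℕ)) x = x :=
  SemidirectProduct.ext (MuN.red_self p M _ x.left) rfl

/-- `red_{M',M} ∘ red_{M'',M'} = red_{M'',M}`. [cite: MochizukiEtTh2009, Def 2.13(ii) p.48] -/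
theorem red_comp {M M' M'' : ℕ+} (h : (M : ℕ) ∣ (M' : ℕ)) (h' : (M' : ℕ) ∣ (M'' : ℕ))
    (x : (levelData C hC hS mods M'').env) :
    red C hC hS mods h (red C hC hS mods h' x) = red C hC hS mods (dvd_trans h h') x :=
  SemidirectProduct.ext (MuN.red_comp p M M' M'' h h' x.left).symm rfl

/-! ### `red` carries `[s^Θ_{η⁰_{M'}}]` onto `[s^Θ_{η⁰_M}]` -/

/-- Theta sections attached to EQUAL cocycles coincide (irrelevance of the membership witness).
[cite: MochizukiEtTh2009, Def 2.13(i) p.47] -/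
theorem sTheta_congr {N : ℕ+} (T : Literature.AnabelianGeometry.EtaleTheta.ThetaEnvData.{0} N)
    {η₁ η₂ : T.PiYdd → T.mu} (h : η₁ = η₂) (h₁ : η₁ ∈ T.thetaCocycles) (h₂ : η₂ ∈ T.thetaCocycles) :
    T.sTheta h₁ = T.sTheta h₂ := by
  subst h
  rfl

include hmods in
/-- `red_{M',M}` conjugated: `red ∘ conj(c') = conj(red c') ∘ red` for `c' ∈ μ_{M'}` (abc-iut-L2-d1's
`reduces_conj_inMu`, pulled down to the pair). [cite: MochizukiEtTh2009, Def 2.13(ii) p.48] -/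
theorem red_comp_conj_inMu {M M' : ℕ+} (h : (M : ℕ) ∣ (M' : ℕ)) (c' : MuN p M') :
    (red C hC hS mods h).comp
        (MulAut.conj (CycEnvelope.inMu (levelData C hC hS mods M').augY
          (levelData C hC hS mods M').chi c')).toMonoidHom =
      (MulAut.conj (CycEnvelope.inMu (levelData C hC hS mods M).augY
          (levelData C hC hS mods M).chi (MuN.red p M M' h c'))).toMonoidHom.comp (red C hC hS mods h) :=
  MonoidHom.ext fun x =>
    (tower C hC hS mods hmods h).reduces_conj_inMu (M := low h) (M' := high h) (h := low_dvd_high h) c' x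

include hmods in
/-- `red_{M',M} ∘ s^Θ_{η⁰_{M'}} = s^Θ_{η⁰_M}` (abc-iut-L2-d1's `redEnv_sTheta` + compatibility of the
identifications `μ_N ≅ (l·Δ_Θ) ⊗ ℤ/Nℤ`). [cite: MochizukiEtTh2009, Def 2.13(ii) p.48] -/
theorem red_comp_sTheta {M M' : ℕ+} (h : (M : ℕ) ∣ (M' : ℕ)) :
    (red C hC hS mods h).comp ((levelData C hC hS mods M').sTheta (eta0_mem C hC hS mods f hf M')) =
      (levelData C hC hS mods M).sTheta (eta0_mem C hC hS mods f hf M) := by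
  have hη : (tower C hC hS mods hmods h).red (low h) (high h) (low_dvd_high h) ∘ eta0 C hC mods f hf M' =
      eta0 C hC mods f hf M :=
    C.red_comp_modN (cyclotomeTower mods hmods h) (low_dvd_high h) f hf.1
  have e2 : ((tower C hC hS mods hmods h).level (low h)).sTheta
        ((tower C hC hS mods hmods h).red_cocycle_mem (low h) (high h) (low_dvd_high h) _
          (eta0_mem C hC hS mods f hf M')) =
      (levelData C hC hS mods M).sTheta (eta0_mem C hC hS mods f hf M) :=
    sTheta_congr _ hη _ _
  refine MonoidHom.ext fun g => ?_
  rw [MonoidHom.comp_apply]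
  exact ((tower C hC hS mods hmods h).redEnv_sTheta (M := low h) (M' := high h) (low_dvd_high h)
    (eta0_mem C hC hS mods f hf M') g).trans (DFunLike.congr_fun e2 g)

include hmods in
/-- **`red_{M',M}` maps the `μ_{M'}`-conjugacy class of `Im s^Θ_{η⁰_{M'}}` ONTO the `μ_M`-conjugacy class of
`Im s^Θ_{η⁰_M}`** ([EtTh] Cor. 2.18 (iv), first half, the theta-section clause of "`M_{N'}` … induced by `M`").
[cite: MochizukiEtTh2009, Def 2.13(ii) p.48] -/
theorem image_map_red_sTheta {M M' : ℕ+} (h : (M : ℕ) ∣ (M' : ℕ)) :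
    (fun H : Subgroup (levelData C hC hS mods M').env => H.map (red C hC hS mods h)) ''
        ((levelData C hC hS mods M').modelMono (eta0_mem C hC hS mods f hf M')).sTheta =
      ((levelData C hC hS mods M).modelMono (eta0_mem C hC hS mods f hf M)).sTheta := by
  have key : ∀ c' : MuN p M',
      (((levelData C hC hS mods M').sTheta (eta0_mem C hC hS mods f hf M')).range.map
          (MulAut.conj (CycEnvelope.inMu (levelData C hC hS mods M').augY
            (levelData C hC hS mods M').chi c')).toMonoidHom).map (red C hC hS mods h) =
        ((levelData C hC hS mods M).sTheta (eta0_mem C hC hS mods f hf M)).range.map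
          (MulAut.conj (CycEnvelope.inMu (levelData C hC hS mods M).augY
            (levelData C hC hS mods M).chi (MuN.red p M M' h c'))).toMonoidHom := by
    intro c'
    rw [Subgroup.map_map, red_comp_conj_inMu C hC hS mods hmods h c', ← Subgroup.map_map,
      MonoidHom.map_range, red_comp_sTheta C hC hS mods f hf hmods h]
  ext K
  constructor
  · rintro ⟨H, ⟨c', rfl⟩, rfl⟩
    exact ⟨MuN.red p M M' h c', key c'⟩
  · rintro ⟨c, rfl⟩
    obtain ⟨c', rfl⟩ := MuN.red_surjective p M M' h c
    exact ⟨_, ⟨c', rfl⟩, key c'⟩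

/-! ### `red` carries `D_Y` to `D_Y` (modulo temp-slimness of `Π^tp_X`) -/

include hmods in
/-- **Every element of `D_Y ⊆ Aut(Π^tp_{Y̲̲}[μ_{M'}])` induces an element of `D_Y ⊆ Aut(Π^tp_{Y̲̲}[μ_M])` along
`red_{M',M}`** — abc-iut-L2-d1's `exists_reduces_contMulAut` + `mk_mem_DY_of_reduces` (the `D_Y`-clause of
[EtTh] Cor. 2.18 (iv): the reduction `Aut^μ(𝕄) → Aut^μ(𝕄_M)`), pulled down to the pair `M ∣ M'`; modulo temp-slimness of
`Π^tp_X` ([SemiAnbd] Ex. 3.10, the interface FACT `IsSlimGroup`), which yields [EtTh] Cor. 2.18 (iii) at level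
`M'` (`cor218_iii_of_tempSlim`). [cite: MochizukiEtTh2009, Cor 2.18(iv) p.61] -/
theorem exists_red_D (hslimX : Literature.AlgebraicGeometry.Frobenioids.IsSlimGroup D.PiTemp)
    {M M' : ℕ+} (h : (M : ℕ) ∣ (M' : ℕ)) :
    ∀ φ' ∈ outToAut (levelData C hC hS mods M').env (levelData C hC hS mods M').DY,
      ∃ φ ∈ outToAut (levelData C hC hS mods M).env (levelData C hC hS mods M).DY,
        ∀ x, red C hC hS mods h (φ' x) = φ (red C hC hS mods h x) := by
  intro φ' hφ'
  have hq := ((tower C hC hS mods hmods h).cor218_iii_of_tempSlim (C.tempSlim_Huu hslimX)).2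
  obtain ⟨hc, hmem⟩ := mem_outToAut_iff.1 hφ'
  obtain ⟨ψ, hψ⟩ := ThetaEnvTower.exists_reduces_contMulAut (T := tower C hC hS mods hmods h)
    (M := low h) (M' := high h) (low_dvd_high h) (hq (high h)) ⟨φ', hc⟩
  have hψD : TopOut.mk ((tower C hC hS mods hmods h).level (low h)).env ψ ∈
      ((tower C hC hS mods hmods h).level (low h)).DY :=
    ThetaEnvTower.mk_mem_DY_of_reduces (low_dvd_high h) (hq (high h)) ⟨φ', hc⟩ hmem ψ hψ
  have hψA : ψ.1 ∈ outToAut ((tower C hC hS mods hmods h).level (low h)).env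
      ((tower C hC hS mods hmods h).level (low h)).DY :=
    mem_outToAut_iff.2 ⟨ψ.2, hψD⟩
  exact ⟨ψ.1, hψA, fun x => hψ x⟩

/-! ## The model reductions, assembled -/

/-- **The model reductions of the model family of `X̲̲_K`** ([EtTh] Def. 2.13 (ii) "`M_{N'}` for the mod `N'`
mono-theta environment induced by `M`", at the models, for ALL `M ∣ M'` in `ℕ_{≥1}`), as abc-iut-L6-t19's
interface `ModelFamily.Reductions` — every field PROVED, `red_D` modulo temp-slimness of `Π^tp_X` (the
interface FACT `IsSlimGroup D.PiTemp`, [SemiAnbd] Ex. 3.10). This is the merge TODO-merge:abc-iut-L2-t2 recorded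
in `MonoThetaProjectiveR.lean`. [claim: Mochizuki2012, status: disputed] (IUTchII §1 Prop 1.5, kurims p.29) -/
def reductions (hslimX : Literature.AlgebraicGeometry.Frobenioids.IsSlimGroup D.PiTemp) :
    (modelFamily C hC hS hl hp2 hpl hζ mods f hf).Reductions where
  red h := red C hC hS mods h
  red_continuous h := continuous_red C hC hS mods hmods h
  red_surjective h := red_surjective C hC hS mods hmods h
  red_refl M x := red_refl C hC hS mods M x
  red_comp h h' x := red_comp C hC hS mods h h' x
  red_D h := exists_red_D C hC hS mods hmods hslimX h
  red_theta h := image_map_red_sTheta C hC hS mods f hf hmods h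

/-- The reductions of `reductions` ARE `red` (bookkeeping). [cite: MochizukiEtTh2009, Def 2.13(ii) p.48] -/
theorem reductions_red (hslimX : Literature.AlgebraicGeometry.Frobenioids.IsSlimGroup D.PiTemp)
    {M M' : ℕ+} (h : (M : ℕ) ∣ (M' : ℕ)) (x : (levelData C hC hS mods M').env) :
    (reductions C hC hS hl hp2 hpl hζ mods f hf hmods hslimX).red h x = red C hC hS mods h x :=
  rfl

end EtaleLevels

end Literature.IUT.HodgeArakelov
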